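import Mathlib
import HarnessLib
import Summits.QuantumFields.YangMills.Theses.CoincidenceRotationBootstrap
import Summits.QuantumFields.YangMills.Theorems.CoincidenceRotationBootstrapHypercubicLimitOneFieldWeak
import Summits.QuantumFields.YangMills.Theorems.MirrorModularBoostsHypercubicLimitPlanesTransfer
import Summits.QuantumFields.YangMills.Theorems.MirrorModularBoostsHypercubicLimitSubschemeDefs
import Summits.QuantumFields.YangMills.Theorems.MirrorModularBoostsHypercubicLimitIRInputsDefs
import Summits.QuantumFields.YangMills.Theorems.MirrorModularBoostsHypercubicLimitPlaneLimitsDefs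
import Summits.QuantumFields.YangMills.Theorems.MirrorModularBoostsHypercubicLimitClosureHalvesDefs
import Summits.QuantumFields.YangMills.Theorems.MirrorModularBoostsHypercubicLimitPlaneLimitsOfBound
import Summits.QuantumFields.YangMills.Theorems.MirrorModularBoostsHypercubicLimitSoftLegsAssemblyMono
import Summits.QuantumFields.YangMills.Theorems.MirrorModularBoostsHypercubicLimitTranslationPlanes
import Summits.QuantumFields.YangMills.Theorems.MirrorModularBoostsHypercubicLimitFunctionalBoundPlanes
import Summits.QuantumFields.YangMills.Theorems.MirrorModularBoostsHypercubicLimitPlaneSumE0E3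
import Summits.QuantumFields.YangMills.Theorems.PencilRigidityWeakCouplingHypercubicLimitIRInputsOfColdPressure
import Summits.QuantumFields.YangMills.Theorems.PencilRigidityWeakCouplingHypercubicLimitRPPosOfPlaneLimits
import Summits.QuantumFields.YangMills.Theorems.PencilRigidityWeakCouplingHypercubicLimitDecayOfRPSpectral
import Summits.QuantumFields.YangMills.Theorems.PencilRigidityWeakCouplingHypercubicLimitSignedPerm

/-!
# Crux `HypercubicLimit` from the coupling-response line's input — the kernel-checked reduction

Crux `stmt-QuantumFields-16154` (`Summit.QuantumFields.YangMills.Theses.CoincidenceRotationBootstrap.HypercubicLimit` =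
`MirrorModularBoosts.WeakCouplingHypercubicLimit` = by `stub_siblingTie` the twin `PencilRigidity.WeakCouplingHypercubicLimit`), line `Sketch`
(coupling response), reshape 10: the tree-side statement that the crux FOLLOWS from the line's single open input.  Hypothesis (the registered
stub `stub_lineInputsPlanes`, stated inline): for every compact simple `G`, a faithful `r` and a species scheme `sch` with `β_k → ∞`, polynomial
volume growth, polynomial multiplicative renormalisation, bounded additive counterterms, the anisotropic order-one coupling response holomorphic and
bounded on a fixed disc for plane-wise disjoint modulations (`ResponseHolomorphyOnePlanes`), and the IR inputs (`IRInputs`: uniform lattice gap,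
RP-spectral clustering, non-triviality and `κ₃` floors).  Conclusion: the crux by name.  Chain (all landed): Cauchy bounds
(`responseDerivBoundsPlanes_of_holomorphy`) ⇒ the moment recursion (`stub_derivToMomentsPlanes`) ⇒ smeared → functional with OS's factorial
currency (`stub_functionalBoundPlanes`) ⇒ compactness (`stub_planeLimits`) ⇒ soft legs (`softLegsPlanes_of_translationMono stub_translationPlanesMono`)
∧ reflection legs (`stub_rpPosOfPlaneLimits`, `stub_signedPermOfPlaneLimits`, `stub_decayOfRPSpectral` of the twin line, `reflHalf_of_pieces`) ⇒
`OneFieldClauses` on the sub-scheme (`oneFieldClauses_of_halves`) ⇒ ONE FIELD SUFFICES (`hypercubicLimit_iff_oneFieldWeak`).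

Refs: OsterwalderSchrader1973/1975; OsterwalderSeiler1978; GlimmJaffe1987 §6.1, §19.
-/

noncomputable section

open scoped SchwartzMap
open MeasureTheory Filter Topology
open Literature.MathematicalPhysics.AQFT Literature.MathematicalPhysics.QuantumLattice
open Literature.MathematicalPhysics.QuantumFieldTheory
open Summit.QuantumFields.YangMills.Cruxes.OSLegsFromFemtoAndGap.DlrCollarTransfer (conn Decay RPPos ConnCS)

namespace Summit.QuantumFields.YangMills.Cruxes.HypercubicLimit.CouplingResponse

/-- **The closure of the line from its landed pieces**: a weak-coupling scheme with polynomial volume growth and renormalisation, bounded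
counterterms, the `k`-uniform plane-resolved `n!`-moment bounds and the IR inputs yields a sub-scheme (still at weak coupling) and a one-field
family with `OneFieldClauses`. [folklore] -/
theorem oneFieldClauses_of_uniformMomentBoundsPlanes
    {G : Type} [Group G] [TopologicalSpace G] [IsTopologicalGroup G] [CompactSpace G] [MeasurableSpace G] [BorelSpace G]
    (r : LatticeRep G) (sch : SpeciesScheme (YMSpecies G)) (hw : sch.HasWeakCouplingLimit) (hpv : PolyVolume sch) (hpr : PolyRenorm r sch)
    (hbm : ∃ Cm : ℝ, ∀ k, |sch.m r.curvature k| ≤ Cm) (hUMB : UniformMomentBoundsPlanes r sch) (hIR : IRInputs r sch) :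
    ∃ (sch' : SpeciesScheme (YMSpecies G)) (S₁ : SchwingerFamily (EuclideanSpace ℝ (Fin 4))),
      sch'.HasWeakCouplingLimit ∧ OneFieldClauses r sch' S₁ := by
  have hUFB : UniformFunctionalBoundPlanes r sch := stub_functionalBoundPlanes G r sch hpv hUMB
  obtain ⟨φ, hφ, T, hPL⟩ := stub_planeLimits G r sch hUFB
  obtain ⟨⟨Δ, C, hΔ, hgap, hrp⟩, -, -⟩ := (irInputs_iff r sch).1 hIR
  have hsoft : SoftHalf r (subseq sch φ hφ) (planeSum T) Δ :=
    softLegsPlanes_of_translationMono stub_translationPlanesMono G r sch φ hφ T hw hpv hpr hUFB hIR hPL Δ hΔ hgap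
  have hβ0 : ∀ᶠ k in atTop, 0 ≤ sch.β k := hw.eventually_ge_atTop 0
  have hE0 := (planeSum_isNormalized_isSymmetric G r sch φ T hPL).1
  have htr := stub_translationPlanesMono G r sch φ hφ T hpv hpr hUFB hPL
  have hrefl : ReflHalf (planeSum T) Δ :=
    Summit.QuantumFields.YangMills.Theorems.WeakCouplingHypercubicLimit.TraceNormColdPressure.reflHalf_of_pieces (planeSum T) hΔ
      hE0 (fun n _ a F hF => htr n a F hF)
      (Summit.QuantumFields.YangMills.Theorems.WeakCouplingHypercubicLimit.TraceNormColdPressure.stub_rpPosOfPlaneLimits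
        G r sch φ hφ T hβ0 hUFB hPL)
      (Summit.QuantumFields.YangMills.Theorems.WeakCouplingHypercubicLimit.TraceNormColdPressure.stub_signedPermOfPlaneLimits
        G r sch φ hφ T hUFB hPL)
      (Summit.QuantumFields.YangMills.Theorems.WeakCouplingHypercubicLimit.TraceNormColdPressure.stub_decayOfRPSpectral
        G r sch φ hφ T Δ C hΔ hpv hpr hbm hUFB hPL hrp)
  exact ⟨subseq sch φ hφ, planeSum T, hasWeakCouplingLimit_subseq sch φ hφ hw, oneFieldClauses_of_halves r _ _ hΔ hsoft hrefl⟩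

/-- **Registered sub-goal `hypercubicLimit_of_lineInputsPlanes` — the crux `HypercubicLimit` BY NAME from the line's input.**  The whole
coupling-response line in one implication: its single open stub (anisotropic C⁺ at order one at weak coupling + the IR data, with polynomial
volume growth / renormalisation and bounded counterterms) implies the shared existence-minus-rotations leg of `YangMills`. [folklore] -/
theorem hypercubicLimit_of_lineInputsPlanes :
    (∀ (G : Type) [Group G] [TopologicalSpace G] [IsTopologicalGroup G] [CompactSpace G], IsCompactSimpleLieGroup G → letI : MeasurableSpace G := borel G; haveI : BorelSpace G := ⟨rfl⟩; ∃ (r : LatticeRep G) (sch : SpeciesScheme (YMSpecies G)), sch.HasWeakCouplingLimit ∧ PolyVolume sch ∧ PolyRenorm r sch ∧ (∃ Cm : ℝ, ∀ k, |sch.m r.curvature k| ≤ Cm) ∧ (∃ (s : ℕ) (ε₁ C₀ : ℝ), 0 < ε₁ ∧ ResponseHolomorphyOnePlanes r sch s ε₁ C₀) ∧ IRInputs r sch) → Summit.QuantumFields.YangMills.Theses.CoincidenceRotationBootstrap.HypercubicLimit := by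
  intro hIn
  refine Summit.QuantumFields.YangMills.Theorems.HypercubicLimit.OneFieldWeak.hypercubicLimit_iff_oneFieldWeak.mpr fun G _ _ _ _ hG => ?_
  letI : MeasurableSpace G := borel G
  haveI : BorelSpace G := ⟨rfl⟩
  obtain ⟨r, sch₀, hw₀, hpv, hpr, hbm, ⟨s, ε₁, C₀, hε₁, hC⟩, hIR⟩ := hIn G hG
  have hUMB : UniformMomentBoundsPlanes r sch₀ :=
    stub_derivToMomentsPlanes G r sch₀ (responseDerivBoundsPlanes_of_holomorphy G r sch₀ s ε₁ C₀ hε₁ hC)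
  obtain ⟨sch, S₁, hw, h₁⟩ := oneFieldClauses_of_uniformMomentBoundsPlanes r sch₀ hw₀ hpv hpr hbm hUMB hIR
  exact ⟨r, sch, S₁, hw, h₁⟩

end Summit.QuantumFields.YangMills.Cruxes.HypercubicLimit.CouplingResponse

end
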